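import Mathlib
import HarnessLib

/-!
# S-procedure logic kit for window certificates (route `BarrierStepRungThree`, repaired format K2″)

Helper lemmas (supporting item stmt-NavierStokesRegularity-23648 `WindowCertificateMargin`): the purely
logical step from S-PROCEDURE-shaped polynomial inequalities — the form in which an SOS / Putinar solver
returns its rational certificates («`p − Σ λᵢ gᵢ` is nonnegative on the box») — to the IMPLICATION-shaped
clauses of the window certificate (`WindowBox.taoLadderRungThree_target_of_boxCertificateSplit₃`,
file `BarrierStepRungThreeWindowBoxReduction.lean`):

* `SProc.pos_of_cert` / `SProc.nonneg_of_cert` / `SProc.le_of_cert` — if `p x ≥ Σ λᵢ gᵢ x` with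
  `λᵢ ≥ 0`, then `p x ≥ 0` wherever all `gᵢ x ≥ 0` (and `p x > 0` if some `λᵢ gᵢ x > 0`);
* `SProc.floor_of_cert` — the CLOCK FLOOR clause `v x ≤ 0 → 0 < g x → -(γc) < v x` from one
  certificate `λ·g x − μ·v x ≤ v x + γc` with `λ > 0`, `μ ≥ 0`;
* `SProc.proper_of_quadratic_lower_bound` — the PROPERNESS clause `v x ≤ 0 → |x i j| ≤ Mw i j` on
  `Fin 4 → Fin n → ℝ` from one global lower bound `Σ ε i j · (x i j)² − C ≤ v x` with `C ≤ ε i j · Mw i j²`;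
* `SProc.abs_ge_of_cert` — the goal threshold `a₀ ≤ |x₁|` from `x₁² − a₀² + λ g + μ v ≥ 0` on
  `{g ≤ 0, v ≤ 0}`;
* `SProc.window_cap_of_margin` — the per-coordinate ENERGY-CAP side condition of clause 20 is met by
  `Φ := Mw²/2 + slack` margins (arithmetic repackaging).

All statements are elementary real-inequality logic (no analysis, no table); they exist so that a
certificate file is `data + solver facts + these lemmas + WindowBox plumbing`.
HONEST FRAMING: bookkeeping only; nothing here is about the Navier–Stokes equations, no certificate is
produced, no summit or rung is proved by this file (MODEL-lane tooling for class rung TL-M3).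
-/

noncomputable section

-- the sub-problem namespace `Summit.NavierStokesRegularity.NavierStokesRegularity` repeats the summit name by design (D-0017)
set_option linter.dupNamespace false

namespace Summit.NavierStokesRegularity.NavierStokesRegularity.Theorems

namespace SProc

variable {X : Type*}

/-- **S-procedure, nonnegative conclusion.** If `Σᵢ λᵢ gᵢ x ≤ p x` with all `λᵢ ≥ 0`, then `p x ≥ 0`
at every point where all `gᵢ x ≥ 0`. [folklore] -/
theorem nonneg_of_cert {ι : Type*} (s : Finset ι) {p : X → ℝ} {g : ι → X → ℝ} {lam : ι → ℝ}
    (hlam : ∀ i ∈ s, 0 ≤ lam i) (hcert : ∀ x, ∑ i ∈ s, lam i * g i x ≤ p x)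
    {x : X} (hg : ∀ i ∈ s, 0 ≤ g i x) : 0 ≤ p x :=
  le_trans (Finset.sum_nonneg fun i hi => mul_nonneg (hlam i hi) (hg i hi)) (hcert x)

/-- **S-procedure, strict conclusion.** If `Σᵢ λᵢ gᵢ x ≤ p x` with all `λᵢ ≥ 0`, all `gᵢ x ≥ 0`, and
ONE term has `λᵢ₀ > 0` and `gᵢ₀ x > 0`, then `p x > 0`. [folklore] -/
theorem pos_of_cert {ι : Type*} (s : Finset ι) {p : X → ℝ} {g : ι → X → ℝ} {lam : ι → ℝ}
    (hlam : ∀ i ∈ s, 0 ≤ lam i) (hcert : ∀ x, ∑ i ∈ s, lam i * g i x ≤ p x)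
    {x : X} (hg : ∀ i ∈ s, 0 ≤ g i x) {i₀ : ι} (hi₀ : i₀ ∈ s) (hl₀ : 0 < lam i₀)
    (hg₀ : 0 < g i₀ x) : 0 < p x := by
  have hsum : lam i₀ * g i₀ x ≤ ∑ i ∈ s, lam i * g i x :=
    Finset.single_le_sum (f := fun i => lam i * g i x) (fun i hi => mul_nonneg (hlam i hi) (hg i hi)) hi₀
  have hpos : 0 < lam i₀ * g i₀ x := mul_pos hl₀ hg₀
  linarith [hcert x]

/-- **S-procedure, comparison form.** If `Σᵢ λᵢ gᵢ x ≤ b x - a x` with `λᵢ ≥ 0`, then `a x ≤ b x`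
wherever all `gᵢ x ≥ 0`. [folklore] -/
theorem le_of_cert {ι : Type*} (s : Finset ι) {a b : X → ℝ} {g : ι → X → ℝ} {lam : ι → ℝ}
    (hlam : ∀ i ∈ s, 0 ≤ lam i) (hcert : ∀ x, ∑ i ∈ s, lam i * g i x ≤ b x - a x)
    {x : X} (hg : ∀ i ∈ s, 0 ≤ g i x) : a x ≤ b x := by
  have := nonneg_of_cert s (p := fun x => b x - a x) hlam hcert hg
  linarith

/-- **Clock FLOOR from one S-procedure certificate.** If `λ·g x − μ·v x ≤ v x + γ·c` for all `x`
with `λ > 0` and `μ ≥ 0`, then `v x ≤ 0 → 0 < g x → -(γ·c) < v x` (clause 25 of the window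
certificate). [folklore] -/
theorem floor_of_cert {v g : X → ℝ} {γ c lam μ : ℝ} (hlam : 0 < lam) (hμ : 0 ≤ μ)
    (hcert : ∀ x, lam * g x - μ * v x ≤ v x + γ * c) :
    ∀ x, v x ≤ 0 → 0 < g x → -(γ * c) < v x := by
  intro x hv hg
  have h1 : 0 < lam * g x := mul_pos hlam hg
  have h2 : 0 ≤ -(μ * v x) := by nlinarith
  linarith [hcert x]

/-- **Goal threshold from one S-procedure certificate.** If `0 ≤ a₀` and
`x₁ x ^ 2 - a₀ ^ 2 + λ·g x + μ·v x ≥ 0` for all `x` with `λ, μ ≥ 0`, then on `{g ≤ 0, v ≤ 0}` one has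
`a₀ ≤ |x₁ x|` (the ratio clause `2^{-θ} ≤ |S_{i₀,1}|` of the goal). [folklore] -/
theorem abs_ge_of_cert {v g x₁ : X → ℝ} {a₀ lam μ : ℝ} (ha₀ : 0 ≤ a₀) (hlam : 0 ≤ lam) (hμ : 0 ≤ μ)
    (hcert : ∀ x, 0 ≤ x₁ x ^ 2 - a₀ ^ 2 + lam * g x + μ * v x) :
    ∀ x, g x ≤ 0 → v x ≤ 0 → a₀ ≤ |x₁ x| := by
  intro x hg hv
  have h1 : lam * g x ≤ 0 := mul_nonpos_of_nonneg_of_nonpos hlam hg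
  have h2 : μ * v x ≤ 0 := mul_nonpos_of_nonneg_of_nonpos hμ hv
  have h3 : a₀ ^ 2 ≤ x₁ x ^ 2 := by linarith [hcert x]
  calc a₀ = |a₀| := (abs_of_nonneg ha₀).symm
    _ ≤ |x₁ x| := sq_le_sq.1 h3

/-- **PROPERNESS from one global quadratic lower bound.** On the window space `Fin 4 → Fin n → ℝ`:
if `Σ_{i,j} ε i j · (x i j)² − C ≤ v x` for every `x`, with `ε > 0`, `Mw ≥ 0` and `C ≤ ε i j · Mw i j²`,
then `v x ≤ 0 → |x i j| ≤ Mw i j` for all `i, j` (clause 24 of the window certificate). [folklore] -/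
theorem proper_of_quadratic_lower_bound {n : ℕ} {v : (Fin 4 → Fin n → ℝ) → ℝ}
    {ε Mw : Fin 4 → Fin n → ℝ} {C : ℝ} (hε : ∀ i j, 0 < ε i j) (hMw : ∀ i j, 0 ≤ Mw i j)
    (hC : ∀ i j, C ≤ ε i j * Mw i j ^ 2)
    (hv : ∀ x : Fin 4 → Fin n → ℝ, (∑ i, ∑ j, ε i j * x i j ^ 2) - C ≤ v x) :
    ∀ x : Fin 4 → Fin n → ℝ, v x ≤ 0 → ∀ i j, |x i j| ≤ Mw i j := by
  intro x hvx i j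
  have hsum : ∑ i, ∑ j, ε i j * x i j ^ 2 ≤ C := by linarith [hv x]
  have hij : ε i j * x i j ^ 2 ≤ ∑ i', ∑ j', ε i' j' * x i' j' ^ 2 := by
    have h1 : ε i j * x i j ^ 2 ≤ ∑ j', ε i j' * x i j' ^ 2 :=
      Finset.single_le_sum (f := fun j' => ε i j' * x i j' ^ 2)
        (fun j' _ => mul_nonneg (hε i j').le (sq_nonneg _)) (Finset.mem_univ j)
    have h2 : ∑ j', ε i j' * x i j' ^ 2 ≤ ∑ i', ∑ j', ε i' j' * x i' j' ^ 2 :=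
      Finset.single_le_sum (f := fun i' => ∑ j', ε i' j' * x i' j' ^ 2)
        (fun i' _ => Finset.sum_nonneg fun j' _ => mul_nonneg (hε i' j').le (sq_nonneg _))
        (Finset.mem_univ i)
    exact h1.trans h2
  have hsq : x i j ^ 2 ≤ Mw i j ^ 2 := by
    have h := (hij.trans hsum).trans (hC i j)
    exact le_of_mul_le_mul_left (by linarith) (hε i j)
  exact abs_le_of_sq_le_sq hsq (hMw i j)

/-- **Window energy caps from properness margins** (clause 20 of the window certificate, arithmetic
form): if the slack majorant term `sΨ := η·Ψ(kLo+j) ≥ 0`, the defect weight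
`w := η·4^(kLo+j)·c` satisfies `w < 1`, and the cap is chosen as `Φ := (Mw²/2 + sΨ + m)/(1 − w)`
with a margin `m > 0`, then `Mw²/2 + sΨ + w·Φ < Φ` and `0 ≤ Φ`. [folklore] -/
theorem window_cap_of_margin {Mw sΨ w m Φ : ℝ} (hs : 0 ≤ sΨ)
    (hw1 : w < 1) (hm : 0 < m) (hΦ : Φ = (Mw ^ 2 / 2 + sΨ + m) / (1 - w)) :
    0 ≤ Φ ∧ Mw ^ 2 / 2 + sΨ + w * Φ < Φ := by
  have h1w : 0 < 1 - w := by linarith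
  have hnum : 0 ≤ Mw ^ 2 / 2 + sΨ + m := by positivity
  refine ⟨by rw [hΦ]; exact div_nonneg hnum h1w.le, ?_⟩
  have key : (1 - w) * Φ = Mw ^ 2 / 2 + sΨ + m := by
    rw [hΦ]; field_simp
  nlinarith [key]

end SProc

end Summit.NavierStokesRegularity.NavierStokesRegularity.Theorems

end
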